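import Mathlib
import Summits.Ventures.PercRepro2.Defs
import Summits.Ventures.PercRepro2.Independence
import Summits.Ventures.PercRepro2.Harris
import Summits.Ventures.PercRepro2.Graph
import Summits.Ventures.PercRepro2.Exploration
import Summits.Ventures.PercRepro2.Induced
import Summits.Ventures.PercRepro2.Frontier
import Summits.Ventures.PercRepro2.ObsIndependence
import Summits.Ventures.PercRepro2.BHK
import Summits.Ventures.PercRepro2.BlockConn

/-!
# The contracted cluster of a root and its exploration (blind cell PercRepro2, mine-1 g53;
paper proofs/MINE1-BLOCKS.md §2.5(d): the lemma the anti-`v` pair needs)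

For a block family `𝒲` the CONTRACTED cluster `C^𝒲_t` of `t` on the induced subgraph `G[U]` is the
set of vertices contracted-connected to `t` (`ConnB` of `BlockConn.lean`, the blocks cut down to
`U`); `R^{𝒲,U}_X = {t ↮_𝒲 x ∀ x ∈ X}` is the avoidance event.  This file is `BHK.lean`'s
cluster-functional toolkit for the contracted cluster: monotonicity, the dependence on the edges
inside `U`, and the DOMAIN MARKOV IDENTITY for exploring the edges around an avoided set `Z`:
on `{t ↮_𝒲 Z}` the contracted cluster of `G[U]` is that of `G[U ∖ Z]`, and the avoided set gains
the frontier of `Z` and the BLOCK-MATES of `Z` (the other vertices of the blocks meeting `Z`):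

  `E[F(C^𝒲_t) 1_{R_{W ∪ Z}}] = ∑_ω weight p ω · E[F(C^{𝒲,U∖Z}_t) 1_{R_{W ∪ frontier ω ∪ mates Z}}]`

(`expect_clusterObsB_mul_indicator_eq_sum`).  `BHKContracted.lean` runs the antitone BHK
induction of `BHKAntitone.lean` on it.
-/

namespace Summit.Ventures.PercRepro2

namespace BlockFamily

section Defs

variable {V : Type*} {E : Type*} {R : Type*} [DecidableEq V]

/-- The blocks cut down to the vertex set `U`. -/
def blocksIn (𝒲 : Finset (Finset V)) (U : Finset V) : Finset (Finset V) :=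
  𝒲.image (fun B => B ∩ U)

/-- The contracted cluster of `t` in `G[U]` (the blocks cut down to `U`). -/
def clusterInB (ends : E → Sym2 V) (U : Finset V) (𝒲 : Finset (Finset V)) (t : V)
    (ω : Config E) : Set V :=
  {x | ConnB ends (induced ends (↑U) ω) (blocksIn 𝒲 U) t x}

/-- A cluster functional evaluated on the contracted cluster of `t` in `G[U]`. -/
def clusterObsB (ends : E → Sym2 V) (U : Finset V) (𝒲 : Finset (Finset V)) (t : V)
    (F : Set V → R) : Config E → R :=
  fun ω => F (clusterInB ends U 𝒲 t ω)

/-- `R^{𝒲,U}_X = {t ↮_𝒲 x in G[U] for all x ∈ X}`. -/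
def REventB (ends : E → Sym2 V) (U : Finset V) (𝒲 : Finset (Finset V)) (t : V) (X : Finset V) :
    Set (Config E) :=
  {ω | ∀ x ∈ X, ¬ ConnB ends (induced ends (↑U) ω) (blocksIn 𝒲 U) t x}

/-- The block-mates of `Z` inside `U`: the vertices of `U ∖ Z` lying in a block that meets `Z`. -/
def matesB (𝒲 : Finset (Finset V)) (U Z : Finset V) : Finset V :=
  ((𝒲.filter (fun B => (B ∩ Z).Nonempty)).biUnion (fun B => B ∩ U)) \ Z

variable {ends : E → Sym2 V} {U : Finset V} {𝒲 : Finset (Finset V)} {t : V}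

/-- Membership in the cut-down blocks. -/
lemma mem_blocksIn {B' : Finset V} : B' ∈ blocksIn 𝒲 U ↔ ∃ B ∈ 𝒲, B ∩ U = B' := by
  simp [blocksIn]

/-- Membership in the contracted cluster. -/
@[simp] lemma mem_clusterInB {ω : Config E} {x : V} :
    x ∈ clusterInB ends U 𝒲 t ω ↔ ConnB ends (induced ends (↑U) ω) (blocksIn 𝒲 U) t x := Iff.rfl

/-- Membership in `REventB`. -/
@[simp] lemma mem_REventB {X : Finset V} {ω : Config E} :
    ω ∈ REventB ends U 𝒲 t X ↔
      ∀ x ∈ X, ¬ ConnB ends (induced ends (↑U) ω) (blocksIn 𝒲 U) t x := Iff.rfl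

/-- Unfolding `clusterObsB`. -/
@[simp] lemma clusterObsB_apply (F : Set V → R) (ω : Config E) :
    clusterObsB ends U 𝒲 t F ω = F (clusterInB ends U 𝒲 t ω) := rfl

/-- Membership in the block-mates. -/
lemma mem_matesB {Z : Finset V} {x : V} :
    x ∈ matesB 𝒲 U Z ↔ (∃ B ∈ 𝒲, (B ∩ Z).Nonempty ∧ x ∈ B ∩ U) ∧ x ∉ Z := by
  simp only [matesB, Finset.mem_sdiff, Finset.mem_biUnion, Finset.mem_filter]
  constructor
  · rintro ⟨⟨B, ⟨hB, hBZ⟩, hx⟩, hxZ⟩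
    exact ⟨⟨B, hB, hBZ, hx⟩, hxZ⟩
  · rintro ⟨⟨B, hB, hBZ, hx⟩, hxZ⟩
    exact ⟨⟨B, ⟨hB, hBZ⟩, hx⟩, hxZ⟩

/-- The block-mates lie in `U ∖ Z`. -/
lemma matesB_subset {Z : Finset V} : matesB 𝒲 U Z ⊆ U \ Z := by
  intro x hx
  obtain ⟨⟨B, _, _, hxB⟩, hxZ⟩ := mem_matesB.1 hx
  exact Finset.mem_sdiff.2 ⟨(Finset.mem_inter.1 hxB).2, hxZ⟩

/-- The contracted cluster is monotone in the configuration. -/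
lemma clusterInB_mono {ω ω' : Config E} (h : ω ≤ ω') :
    clusterInB ends U 𝒲 t ω ⊆ clusterInB ends U 𝒲 t ω' :=
  fun _ hx => connB_mono_config (induced_mono h) hx

/-- `R^{𝒲,U}_X` is decreasing. -/
lemma isLowerSet_REventB (X : Finset V) : IsLowerSet (REventB ends U 𝒲 t X) :=
  fun _ _ h hω x hx hc => hω x hx (connB_mono_config (induced_mono h) hc)

/-- `R^{𝒲,U}` is antitone in the avoided set. -/
lemma REventB_anti {X X' : Finset V} (h : X ⊆ X') :
    REventB ends U 𝒲 t X' ⊆ REventB ends U 𝒲 t X :=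
  fun _ hω x hx => hω x (h hx)

/-- `R^{𝒲,U}_∅` is everything. -/
lemma REventB_empty : REventB ends U 𝒲 t ∅ = Set.univ := by
  ext ω
  simp

/-- `R^{𝒲,U}_{X ∪ Y} = R^{𝒲,U}_X ∩ R^{𝒲,U}_Y`. -/
lemma REventB_union (X Y : Finset V) :
    REventB ends U 𝒲 t (X ∪ Y) = REventB ends U 𝒲 t X ∩ REventB ends U 𝒲 t Y := by
  ext ω
  simp only [mem_REventB, Set.mem_inter_iff, Finset.mem_union]
  constructor
  · intro h
    exact ⟨fun x hx => h x (Or.inl hx), fun x hx => h x (Or.inr hx)⟩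
  · rintro ⟨h1, h2⟩ x (hx | hx)
    · exact h1 x hx
    · exact h2 x hx

/-- `R^{𝒲,U}_X` is empty when `t ∈ X`. -/
lemma REventB_eq_empty_of_mem {X : Finset V} (ht : t ∈ X) : REventB ends U 𝒲 t X = ∅ := by
  ext ω
  simp only [mem_REventB, Set.mem_empty_iff_false, iff_false, not_forall, not_not]
  exact ⟨t, ht, connB_refl t⟩

/-- `clusterObsB` is determined by the edges inside `U`. -/
lemma dependsOn_clusterObsB (F : Set V → R) :
    DependsOn (clusterObsB ends U 𝒲 t F) (within ends (↑U)) := by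
  intro ω ω' h
  simp only [clusterObsB_apply, clusterInB, induced_congr h]

/-- `REventB` is determined by the edges inside `U`. -/
lemma dependsOn_REventB (X : Finset V) :
    DependsOn (· ∈ REventB ends U 𝒲 t X) (within ends (↑U)) := by
  intro ω ω' h
  show (ω ∈ REventB ends U 𝒲 t X) = (ω' ∈ REventB ends U 𝒲 t X)
  simp only [mem_REventB, induced_congr h]

/-- `clusterObsB` of a product is the product. -/
lemma clusterObsB_mul [Mul R] (F₁ F₂ : Set V → R) :
    clusterObsB ends U 𝒲 t (F₁ * F₂) = clusterObsB ends U 𝒲 t F₁ * clusterObsB ends U 𝒲 t F₂ := rfl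

end Defs

/-! ## Exploring the edges around an avoided set -/

section Explore

variable {V : Type*} {E : Type*} [Fintype E] [DecidableEq V] {ends : E → Sym2 V} {U Z : Finset V}
  {𝒲 : Finset (Finset V)} {t : V} {ω : Config E}

omit [Fintype E] in
/-- Every cut-down block of `G[U ∖ Z]` lies in a cut-down block of `G[U]`. -/
lemma blocksIn_sdiff_refines :
    ∀ B' ∈ blocksIn 𝒲 (U \ Z), ∃ B'' ∈ blocksIn 𝒲 U, B' ⊆ B'' := by
  intro B' hB'
  obtain ⟨B, hB, rfl⟩ := mem_blocksIn.1 hB'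
  exact ⟨B ∩ U, mem_blocksIn.2 ⟨B, hB, rfl⟩,
    Finset.inter_subset_inter_left Finset.sdiff_subset⟩

omit [Fintype E] in
/-- Contracted connections in `G[U ∖ Z]` are contracted connections in `G[U]`. -/
lemma connB_of_sdiff_blocks {x y : V}
    (h : ConnB ends (induced ends (↑(U \ Z)) ω) (blocksIn 𝒲 (U \ Z)) x y) :
    ConnB ends (induced ends (↑U) ω) (blocksIn 𝒲 U) x y :=
  connB_mono_blocks blocksIn_sdiff_refines
    (connB_mono_config (induced_mono_set (Finset.coe_subset.2 Finset.sdiff_subset) ω) h)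

omit [Fintype E] in
/-- **Transfer to `G[U ∖ Z]`**: on `{t ↮_𝒲 Z in G[U]}`, a contracted connection from `t` in
`G[U]` is one in `G[U ∖ Z]`, and never enters `Z`. -/
lemma connB_sdiff_of_avoidB (hR : ∀ z ∈ Z, ¬ ConnB ends (induced ends (↑U) ω) (blocksIn 𝒲 U) t z)
    {x : V} (h : ConnB ends (induced ends (↑U) ω) (blocksIn 𝒲 U) t x) :
    ConnB ends (induced ends (↑(U \ Z)) ω) (blocksIn 𝒲 (U \ Z)) t x := by
  have key : ConnB ends (induced ends (↑(U \ Z)) ω) (blocksIn 𝒲 (U \ Z)) t x ∧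
      ConnB ends (induced ends (↑U) ω) (blocksIn 𝒲 U) t x := by
    refine connB_induction (P := fun y => ConnB ends (induced ends (↑(U \ Z)) ω)
      (blocksIn 𝒲 (U \ Z)) t y ∧ ConnB ends (induced ends (↑U) ω) (blocksIn 𝒲 U) t y)
      ⟨connB_refl t, connB_refl t⟩ ?_ h
    rintro b y _ ⟨hb', hb⟩ hby
    have hbZ : ∀ z ∈ Z, ¬ Conn ends (induced ends (↑U) ω) b z := fun z hz hc =>
      hR z hz (connB_trans hb (connB_of_conn hc))
    rcases hby with hby | ⟨B', hB', hbB', hyB'⟩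
    · exact ⟨connB_trans hb' (connB_of_conn (conn_induced_sdiff_of_conn hbZ hby)),
        connB_trans hb (connB_of_conn hby)⟩
    · obtain ⟨B, hB, rfl⟩ := mem_blocksIn.1 hB'
      have hy : ConnB ends (induced ends (↑U) ω) (blocksIn 𝒲 U) t y :=
        connB_trans hb (connB_of_mem_block hB' hbB' hyB')
      have hbZ' : b ∉ Z := fun hbZ'' => hR b hbZ'' hb
      have hyZ' : y ∉ Z := fun hyZ'' => hR y hyZ'' hy
      refine ⟨connB_trans hb' (connB_of_mem_block (mem_blocksIn.2 ⟨B, hB, rfl⟩) ?_ ?_), hy⟩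
      · exact Finset.mem_inter.2 ⟨(Finset.mem_inter.1 hbB').1,
          Finset.mem_sdiff.2 ⟨(Finset.mem_inter.1 hbB').2, hbZ'⟩⟩
      · exact Finset.mem_inter.2 ⟨(Finset.mem_inter.1 hyB').1,
          Finset.mem_sdiff.2 ⟨(Finset.mem_inter.1 hyB').2, hyZ'⟩⟩
  exact key.1

omit [Fintype E] in
/-- On `{t ↮_𝒲 Z in G[U]}` the contracted cluster in `G[U ∖ Z]` is the one in `G[U]`. -/
lemma clusterInB_sdiff_eq (hR : ∀ z ∈ Z, ¬ ConnB ends (induced ends (↑U) ω) (blocksIn 𝒲 U) t z) :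
    clusterInB ends (U \ Z) 𝒲 t ω = clusterInB ends U 𝒲 t ω := by
  ext x
  simp only [mem_clusterInB]
  exact ⟨connB_of_sdiff_blocks, connB_sdiff_of_avoidB hR⟩

/-- **The avoidance identity**: for `t ∉ Z ⊆ U`, `{t ↮_𝒲 W ∪ Z in G[U]}` is, pointwise,
`{t ↮_𝒲 W ∪ frontier ∪ mates in G[U ∖ Z]}` — the frontier of `Z` and the block-mates of `Z` are
the new avoided vertices. -/
lemma REventB_union_eq (hZU : Z ⊆ U) (htZ : t ∉ Z) (W : Finset V) :
    ω ∈ REventB ends U 𝒲 t (W ∪ Z) ↔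
      ω ∈ REventB ends (U \ Z) 𝒲 t (W ∪ frontier ends U Z ω ∪ matesB 𝒲 U Z) := by
  simp only [mem_REventB, Finset.mem_union]
  constructor
  · intro h x hx hc
    have hc' := connB_of_sdiff_blocks hc
    rcases hx with (hx | hx) | hx
    · exact h x (Or.inl hx) hc'
    · -- a frontier vertex is joined to `z` by an open edge
      obtain ⟨⟨hxU, _⟩, e, he, z, hz, hends⟩ := mem_frontier.1 hx
      refine h z (Or.inr hz) (connB_trans hc' (connB_of_conn (conn_of_openAdj ⟨e, ?_, hends⟩)))
      exact induced_eq_true_iff.2 ⟨he, x, Finset.mem_coe.2 hxU, z, Finset.mem_coe.2 (hZU hz), hends⟩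
    · -- a block-mate shares a block with some `z ∈ Z`
      obtain ⟨⟨B, hB, ⟨z, hz⟩, hxB⟩, _⟩ := mem_matesB.1 hx
      have hzU : z ∈ B ∩ U :=
        Finset.mem_inter.2 ⟨(Finset.mem_inter.1 hz).1, hZU (Finset.mem_inter.1 hz).2⟩
      exact h z (Or.inr (Finset.mem_inter.1 hz).2)
        (connB_trans hc' (connB_of_mem_block (mem_blocksIn.2 ⟨B, hB, rfl⟩) hxB hzU))
  · intro h x hx hc
    -- every contracted connection from `t` in `G[U]` is one in `G[U ∖ Z]` and stays out of `Z`
    have key : ∀ y, ConnB ends (induced ends (↑U) ω) (blocksIn 𝒲 U) t y →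
        ConnB ends (induced ends (↑(U \ Z)) ω) (blocksIn 𝒲 (U \ Z)) t y ∧ y ∉ Z := by
      intro y hy
      refine connB_induction (P := fun y => ConnB ends (induced ends (↑(U \ Z)) ω)
        (blocksIn 𝒲 (U \ Z)) t y ∧ y ∉ Z) ⟨connB_refl t, htZ⟩ ?_ hy
      rintro b y _ ⟨hb', hbZ⟩ hby
      rcases hby with hby | ⟨B', hB', hbB', hyB'⟩
      · -- a plain connection `b ↔ y` in `G[U]`: it avoids `Z`, else `b` reaches the frontier
        have hbF : ∀ z ∈ Z, ¬ Conn ends (induced ends (↑U) ω) b z := by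
          refine not_conn_of_not_conn_frontier hbZ fun y' hy' hc' => ?_
          exact h y' (Or.inl (Or.inr hy')) (connB_trans hb' (connB_of_conn hc'))
        exact ⟨connB_trans hb' (connB_of_conn (conn_induced_sdiff_of_conn hbF hby)),
          fun hyZ => hbF y hyZ hby⟩
      · -- a block step: `y ∈ Z` would make `b` a block-mate of `Z`
        obtain ⟨B, hB, rfl⟩ := mem_blocksIn.1 hB'
        have hyZ : y ∉ Z := fun hyZ => h b (Or.inr (mem_matesB.2
          ⟨⟨B, hB, ⟨y, Finset.mem_inter.2 ⟨(Finset.mem_inter.1 hyB').1, hyZ⟩⟩, hbB'⟩, hbZ⟩)) hb'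
        refine ⟨connB_trans hb' (connB_of_mem_block (mem_blocksIn.2 ⟨B, hB, rfl⟩) ?_ ?_), hyZ⟩
        · exact Finset.mem_inter.2 ⟨(Finset.mem_inter.1 hbB').1,
            Finset.mem_sdiff.2 ⟨(Finset.mem_inter.1 hbB').2, hbZ⟩⟩
        · exact Finset.mem_inter.2 ⟨(Finset.mem_inter.1 hyB').1,
            Finset.mem_sdiff.2 ⟨(Finset.mem_inter.1 hyB').2, hyZ⟩⟩
    obtain ⟨hc', hxZ⟩ := key x hc
    rcases hx with hx | hx
    · exact h x (Or.inl (Or.inl hx)) hc'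
    · exact hxZ hx

end Explore

/-! ## The domain Markov identity for contracted cluster functionals -/

section DMP

variable {V : Type*} {E : Type*} [Fintype E] [DecidableEq E] [Fintype V] [DecidableEq V]
  {R : Type*} [CommRing R]

omit [DecidableEq E] [Fintype V] in
/-- **Pointwise transfer to `G[U ∖ Z]`**: for `t ∉ Z ⊆ U`,
`F(C^𝒲_t) · 1_{R_{W ∪ Z}} = F(C^{𝒲,U∖Z}_t) · 1_{R_{W ∪ frontier ∪ mates}}` configuration by
configuration. -/
lemma clusterObsB_mul_indicator_eq (ends : E → Sym2 V) {U Z : Finset V} (hZU : Z ⊆ U)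
    (𝒲 : Finset (Finset V)) {t : V} (htZ : t ∉ Z) (F : Set V → R) (W : Finset V) (ω : Config E) :
    (clusterObsB ends U 𝒲 t F * (REventB ends U 𝒲 t (W ∪ Z)).indicator (1 : Config E → R)) ω =
      (clusterObsB ends (U \ Z) 𝒲 t F *
        (REventB ends (U \ Z) 𝒲 t (W ∪ frontier ends U Z ω ∪ matesB 𝒲 U Z)).indicator
          (1 : Config E → R)) ω := by
  have key := REventB_union_eq (ends := ends) (ω := ω) (𝒲 := 𝒲) hZU htZ W
  simp only [Pi.mul_apply]
  by_cases h : ω ∈ REventB ends U 𝒲 t (W ∪ Z)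
  · have hR : ∀ z ∈ Z, ¬ ConnB ends (induced ends (↑U) ω) (blocksIn 𝒲 U) t z :=
      fun z hz => h z (Finset.mem_union_right W hz)
    rw [Set.indicator_of_mem h, Set.indicator_of_mem (key.1 h), clusterObsB_apply,
      clusterObsB_apply, clusterInB_sdiff_eq hR]
  · rw [Set.indicator_of_notMem h, Set.indicator_of_notMem fun h' => h (key.2 h'), mul_zero,
      mul_zero]

/-- **Domain Markov identity for contracted cluster functionals**: for `t ∉ Z ⊆ U`,
`E(F(C^𝒲_t) 1_{R_{W∪Z}}) = ∑_ω weight p ω · E(F(C^{𝒲,U∖Z}_t) 1_{R_{W ∪ frontier ω ∪ mates Z}})`. -/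
theorem expect_clusterObsB_mul_indicator_eq_sum (p : E → R) (ends : E → Sym2 V) {U Z : Finset V}
    (hZU : Z ⊆ U) (𝒲 : Finset (Finset V)) {t : V} (htZ : t ∉ Z) (F : Set V → R) (W : Finset V) :
    expect p (clusterObsB ends U 𝒲 t F * (REventB ends U 𝒲 t (W ∪ Z)).indicator 1) =
      ∑ ω, weight p ω * expect p (clusterObsB ends (U \ Z) 𝒲 t F *
        (REventB ends (U \ Z) 𝒲 t (W ∪ frontier ends U Z ω ∪ matesB 𝒲 U Z)).indicator 1) := by
  have e : (clusterObsB ends U 𝒲 t F * (REventB ends U 𝒲 t (W ∪ Z)).indicator (1 : Config E → R)) =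
      fun ω => (clusterObsB ends (U \ Z) 𝒲 t F *
        (REventB ends (U \ Z) 𝒲 t (W ∪ frontier ends U Z ω ∪ matesB 𝒲 U Z)).indicator
          (1 : Config E → R)) ω :=
    funext fun ω => clusterObsB_mul_indicator_eq ends hZU 𝒲 htZ F W ω
  rw [e]
  exact expect_tower p (F₁ := fun _ => touches ends (↑Z)) (F₂ := fun _ => within ends (↑(U \ Z)))
    (S := frontier ends U Z)
    (Φ := fun T => clusterObsB ends (U \ Z) 𝒲 t F *
      (REventB ends (U \ Z) 𝒲 t (W ∪ T ∪ matesB 𝒲 U Z)).indicator 1)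
    (fun _ => disjoint_touches_within_sdiff ends U Z)
    (fun T ω ω' h => by
      show (frontier ends U Z ω = T) = (frontier ends U Z ω' = T)
      rw [dependsOn_frontier ends U Z h])
    fun T => dependsOn_mul (dependsOn_clusterObsB F)
      (dependsOn_indicator (dependsOn_REventB (W ∪ T ∪ matesB 𝒲 U Z)))

end DMP

end BlockFamily

end Summit.Ventures.PercRepro2
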